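import Summits.ResolutionOfSingularities.ResolutionOfSingularities.Theorems.HilbertSamuelEliminationSigmaMaxModificationsCorridor3CPFrameBlowupGlue
import Summits.ResolutionOfSingularities.ResolutionOfSingularities.Theorems.HilbertSamuelEliminationSigmaMaxModificationsCorridor3WLadderStrataBirthsTopDictionaryGraded
import Literature.AlgebraicGeometry.Resolution.BlowupStalkBlowupAlgebra
import HarnessLib

/-!
# [OURS · L1 W4.2] D18 (P2b-glue), SCHEME READING: at every point `x'` of a blow-up over `x_n`, a CP-frame presentation
# `𝒪_{X_n,x_n} → B` yields a presentation `𝒪_{X_{n+1},x'} → (B[C_{x_n}B/c_j])_{𝔔'}` ON A CHART ALGEBRA OF `B`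
# (cell res-hironaka, LADDER-RESOLUTION rung L; slot W4.2, crux chain w42 `SigmaMaxModificationsCorridor3` stmt-ResolutionOfSingularities-19249;
# `--supports stmt-ResolutionOfSingularities-19249 --as helper`; res-L1-w42-plan-1 GO F-74 12:34:43Z «(P2b-glue)»; hand res-D-brk-3 (gen 6), cut G2
# of TAKING 13:03:41Z; G1 = `…Corridor3CPFrameBlowupGlue` p534278)

0 `def`s, every declaration PROVED; OURS bookkeeping; NOT a statement of Hironaka's manuscript [Hironaka2017] nor of [CossartJannsenSaito2020] /
[CossartPiltant2019]. AI-written, weaker than expert review.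

WHAT. `exists_chart_presentation_of_isBlowup`: let `π : X' → X` be a blowing up along `C` (`IsBlowup`), `x' ∈ X'`, `A = 𝒪_{X,π x'}`,
`φ : A → B` FLAT into a local ring with `𝔪_A B = 𝔪_B` and `A → B/𝔪_B` onto (the presentation clauses of res-type-067's `IsCPFrame`), and
`c₁, …, c_k` generators of the stalk `I = C_{π x'}`. Then for the chart index `j` of `x'` (tree `IsBlowup.exists_blowupAlgebra_stalk_ringEquiv`,
Stacks 0804: `𝒪_{X',x'} ≅ (A[I/c_j])_𝔔`) there are a PRIME `𝔔'` of the chart algebra `B[IB/φ(c_j)]` lying over `𝔪_B` and a ring map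
`ψ' : 𝒪_{X',x'} → (B[IB/φ(c_j)])_{𝔔'}` which is FLAT, LOCAL, maps `𝔪_{x'}` ONTO the maximal ideal, is onto on residue fields, and is
compatible with `π^♯_{x'}` and `φ` — G1's `localRingHom_blowupAlgebraMap_presentation` composed with the stalk dictionary. Read on a CP frame of
a marked stage (`IsCPFrame.exists_chart_presentation`, universe `0`, any ideal sheaf `C` and any point `x'` of `blowup C` over `x_n`, the
generators being chosen from the Noetherian stalk): the presentation clauses of the frame persist at `x'`, the new target being a
localisation of a chart algebra of `R[X]/(h)` at a prime over its maximal ideal. What is NOT here (next files of the cut): the change to a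
`u_{j₀}`-chart of the hypersurface and its identification with `R[I_J/u_{j₀}][X']/(h')` (p526498), the near-point shape (p529392), minimality.

References: The Stacks Project, Tags 0804, 0805 [StacksProject]; tree `Resolution/BlowupStalkBlowupAlgebra` (`IsBlowup.exists_blowupAlgebra_stalk_ringEquiv_of_eq`),
`…Corridor3CPFrameBlowupGlue` (G1); HOME STATUS res-L1-w42-plan-1 12:34:43Z, res-D-brk-3 13:03:41Z.
-/

noncomputable section

set_option linter.dupNamespace false

open CategoryTheory AlgebraicGeometry TopologicalSpace IsLocalRing Polynomial
open Literature.AlgebraicGeometry.Resolution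

universe u

namespace Summit.ResolutionOfSingularities.ResolutionOfSingularities.Theorems.SigmaMaxModificationsCorridor3.Helpers

/-- For a bijective homomorphism of local (semi)rings, the maximal ideal is mapped ONTO the maximal ideal. (Stated over
`CommSemiring` so that it instantiates at Mathlib's localisations without an instance-path mismatch.) [folklore] -/
theorem map_maximalIdeal_of_bijective {O O' : Type*} [CommSemiring O] [CommSemiring O'] [IsLocalRing O] [IsLocalRing O']
    (f : O →+* O') (hf : Function.Bijective f) : (maximalIdeal O).map f = maximalIdeal O' := by
  refine le_antisymm (Ideal.map_le_iff_le_comap.mpr fun x hx => ?_) fun y hy => ?_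
  · rw [Ideal.mem_comap]
    refine (IsLocalRing.mem_maximalIdeal _).mpr fun hu => (IsLocalRing.mem_maximalIdeal _).mp hx ?_
    have hu' : IsUnit (RingEquiv.ofBijective f hf x) := hu
    exact (MulEquiv.isUnit_map (RingEquiv.ofBijective f hf)).mp hu'
  · obtain ⟨x, rfl⟩ := hf.2 y
    exact Ideal.mem_map_of_mem f ((IsLocalRing.mem_maximalIdeal _).mpr fun hu => (IsLocalRing.mem_maximalIdeal _).mp hy (hu.map f))

set_option maxHeartbeats 800000 in
-- instance unification on localisations of the affine blowup algebras (subalgebras of `Localization.Away`) is slow, as in the tree's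
-- `BlowupStalkBlowupAlgebra.lean`
/-- [OURS · L1 W4.2] **The glue read through a localisation presentation** (pure algebra): in the setting of
`localRingHom_blowupAlgebraMap_presentation` (`A → B` flat local with `𝔪_A B = 𝔪_B`, `A → B/𝔪_B` onto; `I ⊆ A`, `a ∈ A`; `𝔔` a prime of
`A[I/a]` over `𝔪_A`), ANY local ring `O₀` given with an isomorphism `e : O₀ ≅ (A[I/a])_𝔔` (e.g. `O₀ = 𝒪_{X',x'}` by the stalk dictionary)
acquires `ψ' : O₀ → (B[IB/a])_{𝔔'}`, `𝔔' = 𝔔·B[IB/a]` prime over `𝔪_B`, FLAT, local, `𝔪 ↦ 𝔪` onto, residue-onto, with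
`ψ' (e⁻¹ (r/1)) = ψ(r)/1`. [cite: StacksProject, Tag 0805] -/
theorem exists_presentation_of_ringEquiv_localization {A B : Type u} [CommRing A] [CommRing B] [Algebra A B] [IsLocalRing A]
    [IsLocalRing B] [Module.Flat A B] (I : Ideal A) (a : A) (hmax : (maximalIdeal A).map (algebraMap A B) = maximalIdeal B)
    (hres : Function.Surjective ((residue B).comp (algebraMap A B))) (𝔔 : Ideal (blowupAlgebra I a)) [𝔔.IsPrime]
    (h𝔔 : 𝔔.comap (algebraMap A (blowupAlgebra I a)) = maximalIdeal A)
    {O₀ : Type u} [CommRing O₀] [IsLocalRing O₀] (e : O₀ ≃+* Localization.AtPrime 𝔔) :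
    ∃ (𝔔' : Ideal (blowupAlgebra (I.map (algebraMap A B)) (algebraMap A B a))) (_ : 𝔔'.IsPrime)
      (ψ' : O₀ →+* Localization.AtPrime 𝔔'),
      𝔔'.comap (algebraMap B (blowupAlgebra (I.map (algebraMap A B)) (algebraMap A B a))) = maximalIdeal B ∧
      @RingHom.Flat O₀ (Localization.AtPrime 𝔔') _ _ ψ' ∧ IsLocalHom ψ' ∧
      (maximalIdeal O₀).map ψ' = maximalIdeal (Localization.AtPrime 𝔔') ∧
      Function.Surjective ((residue (Localization.AtPrime 𝔔')).comp ψ') ∧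
      ∀ r : blowupAlgebra I a, ψ' (e.symm (algebraMap (blowupAlgebra I a) (Localization.AtPrime 𝔔) r)) =
        algebraMap (blowupAlgebra (I.map (algebraMap A B)) (algebraMap A B a)) (Localization.AtPrime 𝔔')
          (blowupAlgebraMap (algebraMap A B) I (I.map (algebraMap A B)) a le_rfl r) := by
  have h𝔔le : (maximalIdeal A).map (algebraMap A (blowupAlgebra I a)) ≤ 𝔔 := Ideal.map_le_iff_le_comap.mpr h𝔔.ge
  haveI h𝔔'p : (𝔔.map (blowupAlgebraMap (algebraMap A B) I (I.map (algebraMap A B)) a le_rfl)).IsPrime :=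
    isPrime_map_blowupAlgebraMap I _ a le_rfl le_rfl hmax hres 𝔔 h𝔔le
  have h𝔔'c : (𝔔.map (blowupAlgebraMap (algebraMap A B) I (I.map (algebraMap A B)) a le_rfl)).comap
      (blowupAlgebraMap (algebraMap A B) I (I.map (algebraMap A B)) a le_rfl) = 𝔔 :=
    comap_map_blowupAlgebraMap I _ a le_rfl le_rfl hmax 𝔔
  obtain ⟨hflatl, hlocl, hmapl, hresl⟩ :=
    localRingHom_blowupAlgebraMap_presentation I _ a le_rfl le_rfl hmax hres 𝔔 h𝔔le _ h𝔔'c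
  have hbij : Function.Bijective (e : O₀ →+* Localization.AtPrime 𝔔) := e.bijective
  have hmape : (maximalIdeal O₀).map (e : O₀ →+* Localization.AtPrime 𝔔) = maximalIdeal (Localization.AtPrime 𝔔) :=
    map_maximalIdeal_of_bijective _ hbij
  refine ⟨_, h𝔔'p, (Localization.localRingHom 𝔔 _ _ h𝔔'c.symm).comp (e : O₀ →+* Localization.AtPrime 𝔔),
    comap_algebraMap_map_blowupAlgebraMap I _ a le_rfl le_rfl hmax hres 𝔔 h𝔔, ?_, RingHom.isLocalHom_comp _ _, ?_, ?_, ?_⟩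
  · exact RingHom.Flat.comp (RingHom.Flat.of_bijective e.bijective) hflatl
  · rw [← Ideal.map_map, hmape, hmapl]
  · intro ρ
    obtain ⟨v, hv⟩ := hresl ρ
    refine ⟨e.symm v, ?_⟩
    rw [RingHom.comp_apply, RingHom.comp_apply, RingHom.coe_coe, e.apply_symm_apply]
    exact hv
  · intro r
    rw [RingHom.comp_apply, RingHom.coe_coe, e.apply_symm_apply, Localization.localRingHom_to_map]

set_option maxHeartbeats 800000 in
-- the stalk dictionary `IsBlowup.exists_blowupAlgebra_stalk_ringEquiv_of_eq` elaborates large terms (as in `BlowupStalkBlowupAlgebra.lean`)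
/-- [OURS · L1 W4.2] **D18 (P2b-glue), scheme reading.** Let `π : X' → X` be a blowing up along `C`, `x' ∈ X'`, and `φ : 𝒪_{X,π x'} → B`
a FLAT map to a local ring with `𝔪 B = 𝔪_B` and `𝒪_{X,π x'} → B/𝔪_B` onto; let `I = (c₁, …, c_k) = C_{π x'}`. Then for some chart index
`j` there are a prime `𝔔'` of `B[IB/φ(c_j)]` over `𝔪_B` and `ψ' : 𝒪_{X',x'} → (B[IB/φ(c_j)])_{𝔔'}` FLAT, local, with `𝔪_{x'} ↦ 𝔪` onto,
residue-onto, and `ψ' ∘ π^♯_{x'} = (B → B[IB/φ c_j] → loc) ∘ φ`. [cite: StacksProject, Tag 0804; StacksProject, Tag 0805] -/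
theorem exists_chart_presentation_of_isBlowup {X X' : Scheme.{u}} {π : X' ⟶ X} {C : X.IdealSheafData} (hπ : IsBlowup π C)
    (x' : X') {s₀ : X} (hx : π.base x' = s₀) {B : Type u} [CommRing B] [IsLocalRing B]
    (φ : (X.presheaf.stalk s₀ : Type u) →+* B) (hflat : φ.Flat)
    (hmax : (maximalIdeal _).map φ = maximalIdeal B) (hres : Function.Surjective ((residue B).comp φ))
    {k : ℕ} (c : Fin k → X.presheaf.stalk s₀) (I : Ideal (X.presheaf.stalk s₀))
    (hI : I = Ideal.span (Set.range c)) (hcI : I = stalkIdeal C s₀) :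
    ∃ (j : Fin k) (𝔔' : Ideal (blowupAlgebra (I.map φ) (φ (c j)))) (_ : 𝔔'.IsPrime)
      (ψ' : (X'.presheaf.stalk x' : Type u) →+* Localization.AtPrime 𝔔'),
      𝔔'.comap (algebraMap B (blowupAlgebra (I.map φ) (φ (c j)))) = maximalIdeal B ∧
      @RingHom.Flat (X'.presheaf.stalk x' : Type u) (Localization.AtPrime 𝔔') _ _ ψ' ∧ IsLocalHom ψ' ∧
      (maximalIdeal (X'.presheaf.stalk x')).map ψ' = maximalIdeal (Localization.AtPrime 𝔔') ∧
      Function.Surjective ((residue (Localization.AtPrime 𝔔')).comp ψ') ∧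
      ∀ a, ψ' ((π.stalkMap x').hom a) =
        algebraMap (blowupAlgebra (I.map φ) (φ (c j))) (Localization.AtPrime 𝔔')
          (algebraMap B (blowupAlgebra (I.map φ) (φ (c j))) (φ ((X.presheaf.stalkCongr (Inseparable.of_eq hx)).hom a))) := by
  subst hx
  -- the stalk dictionary: `𝒪_{X',x'} ≅ (A[I/c_j])_𝔔`
  obtain ⟨j, 𝔔, χ, e, hχ, -, he, h𝔔⟩ := hπ.exists_blowupAlgebra_stalk_ringEquiv_of_eq x' c I hI hcI
  letI := φ.toAlgebra
  haveI : Module.Flat (X.presheaf.stalk (π.base x') : Type u) B := hflat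
  obtain ⟨𝔔', h𝔔'p, ψ', h1, h2, h3, h4, h5, h6⟩ :=
    exists_presentation_of_ringEquiv_localization I (c j) hmax hres 𝔔.asIdeal h𝔔 e
  refine ⟨j, 𝔔', h𝔔'p, ψ', h1, h2, h3, h4, h5, fun a => ?_⟩
  have hea : (π.stalkMap x').hom a = e.symm (algebraMap _ (Localization.AtPrime 𝔔.asIdeal) (algebraMap _ (blowupAlgebra I (c j)) a)) := by
    rw [← he, hχ, e.symm_apply_apply]
  rw [TopCat.Presheaf.stalkCongr_hom, stalkSpecializes_self_apply, hea, h6, blowupAlgebraMap_algebraMap]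
  rfl

end Summit.ResolutionOfSingularities.ResolutionOfSingularities.Theorems.SigmaMaxModificationsCorridor3.Helpers

namespace Summit.ResolutionOfSingularities.ResolutionOfSingularities.Theorems.SigmaMaxModificationsCorridor3.Moving

open Summit.ResolutionOfSingularities.ResolutionOfSingularities.Theorems.CampaignW42
open Summit.ResolutionOfSingularities.ResolutionOfSingularities.Theorems.SigmaMaxModificationsCorridor3.Helpers

set_option maxHeartbeats 400000 in
/-- [OURS · L1 W4.2] **(P2b-glue) read on a CP frame of a marked stage.** For a CP frame `(R, u, h, φ)` of `s` (`IsCPFrame`, universe `0`), any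
ideal sheaf `C` on `X_n` and any point `x'` of `blowup C` over `x_n`: choosing generators `c` of `C_{x_n}` (the stalk is Noetherian), for some
chart index `j` there are a prime `𝔔'` of the chart algebra `(R[X]/(h))[C_{x_n}·(R[X]/(h)) / φ(c_j)]` over the maximal ideal and
`ψ' : 𝒪_{blowup C, x'} → (chart algebra)_{𝔔'}` FLAT, local, `𝔪 ↦ 𝔪` onto, residue-onto — the presentation clauses of the frame persist at
`x'` — compatible with `(blowup.π C)^♯_{x'}` and `φ` (up to the canonical identification of the stalks at `(blowup.π C) x' = x_n`).
[cite: StacksProject, Tag 0804; StacksProject, Tag 0805] -/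
theorem IsCPFrame.exists_chart_presentation {s : MarkedStage.{0}} {R : Type} [CommRing R] {u : Fin 3 → R} {h : R[X]}
    [IsLocalRing (R[X] ⧸ Ideal.span {h})] {φ : (s.W.presheaf.stalk s.pt : Type) →+* R[X] ⧸ Ideal.span {h}}
    (hF : IsCPFrame s R u h φ) (C : s.W.IdealSheafData) (x' : ↥(blowup C)) (hx' : (blowup.π C).base x' = s.pt) :
    ∃ (k : ℕ) (c : Fin k → s.W.presheaf.stalk s.pt) (j : Fin k)
      (𝔔' : Ideal (blowupAlgebra ((stalkIdeal C s.pt).map φ) (φ (c j)))) (_ : 𝔔'.IsPrime)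
      (ψ' : ((blowup C).presheaf.stalk x' : Type) →+* Localization.AtPrime 𝔔'),
      Ideal.span (Set.range c) = stalkIdeal C s.pt ∧
      𝔔'.comap (algebraMap (R[X] ⧸ Ideal.span {h}) (blowupAlgebra ((stalkIdeal C s.pt).map φ) (φ (c j)))) =
        maximalIdeal (R[X] ⧸ Ideal.span {h}) ∧
      @RingHom.Flat ((blowup C).presheaf.stalk x' : Type) (Localization.AtPrime 𝔔') _ _ ψ' ∧ IsLocalHom ψ' ∧
      (maximalIdeal ((blowup C).presheaf.stalk x')).map ψ' = maximalIdeal (Localization.AtPrime 𝔔') ∧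
      Function.Surjective ((residue (Localization.AtPrime 𝔔')).comp ψ') ∧
      ∀ a, ψ' (((blowup.π C).stalkMap x').hom a) =
        algebraMap (blowupAlgebra ((stalkIdeal C s.pt).map φ) (φ (c j))) (Localization.AtPrime 𝔔')
          (algebraMap (R[X] ⧸ Ideal.span {h}) (blowupAlgebra ((stalkIdeal C s.pt).map φ) (φ (c j)))
            (φ ((s.W.presheaf.stalkCongr (Inseparable.of_eq hx')).hom a))) := by
  obtain ⟨hR, hloc, hdim, hu, hmon, hφl, hflat, hmap, hsurj, hmin⟩ := hF
  haveI : IsLocallyNoetherian s.W := s.ln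
  -- generators of the Noetherian stalk ideal
  have hfg : (stalkIdeal C s.pt).FG := IsNoetherian.noetherian _
  obtain ⟨k, c, hc⟩ := Submodule.fg_iff_exists_fin_generating_family.mp hfg
  obtain ⟨j, 𝔔', h𝔔'p, ψ', h1, h2, h3, h4, h5, h6⟩ :=
    exists_chart_presentation_of_isBlowup (blowup.isBlowup C) x' hx' φ hflat hmap hsurj c (stalkIdeal C s.pt) hc.symm rfl
  exact ⟨k, c, j, 𝔔', h𝔔'p, ψ', hc, h1, h2, h3, h4, h5, h6⟩

end Summit.ResolutionOfSingularities.ResolutionOfSingularities.Theorems.SigmaMaxModificationsCorridor3.Moving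

end
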